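import Literature.NumberTheory.EllipticCurves.PAdicDistributionModule
import Literature.NumberTheory.EllipticCurves.HidaOrdinaryCohomologyCocycles
import HarnessLib

/-!
# Cocycles of `Γ₀(N)` with coefficients in a right `M₂(ℤ)`-module, their `U_p`, and the
# specialisation of distribution-valued cocycles to `Symⁿ`-valued ones

`HidaOrdinaryCohomologyCocycles` develops the inhomogeneous `1`-cocycles of `Γ₀(N)` with
coefficients `(R^{n+1}, a ↦ Symⁿ(M) a)` and Shimura's Hecke operator `U_p` on them.  Its proofs use
only that the coefficient action `act n` is a right action (`act_mul`, `act_one`) by `R`-linear maps.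
This file records the same constructions for an ARBITRARY coefficient system — an `R`-module `V`
with a right action `ρ` of `M₂(ℤ)` by `R`-linear maps (`CoeffAction`) — and their functoriality in
morphisms of coefficient systems (`CoeffAction.Hom`):

* `A.cocycles N`, `A.heckeU N hp`, `A.heckeU_mem_cocycles`, `A.heckeUZ N hp` (verbatim
  generalisations; for `A = symPowAction n R` they ARE the objects of `HidaOrdinaryCohomologyCocycles`:
  `symPowAction_cocycles`, `symPowAction_heckeU`);
* a morphism `S : A → B` of coefficient systems maps cocycles to cocycles (`Hom.mapFun_mem_cocycles`)
  and commutes with `U_p` (`Hom.mapFun_heckeU`, `Hom.mapCocycles_heckeUZ`);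
* the coefficient system `distAction p = (𝔻(ℤ_p × ℤ_p), actD)` of bounded `ℚ_p`-valued distributions
  (`PAdicDistributionModule`) and the morphisms `specializeHom p n : 𝔻 → (ℚ_p^{n+1}, act n)` given by
  the weight-`n` specialisation (`specializeₗ_actD`).

Consequently (`specialize_mem_cocycles`, `specialize_heckeU`) **a `𝔻`-valued cocycle of `Γ₀(N)`
specialises, in every weight `n + 2`, to a `Symⁿ`-valued cocycle, Hecke-equivariantly for `U_p`** —
the mechanism by which one `𝔻`-valued (`Λ`-adic) ordinary cohomology class interpolates classical
ones of all weights (Greenberg–Stevens 1993, §1, §4–§6; Kitagawa 1994, §5; Hida, *Elementary Modular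
Iwasawa Theory*, §4.2).  The control theorem (surjectivity/injectivity of the specialisation on
ordinary parts) is NOT addressed here.

Brick B2d of the bottom-up plan recorded with the named fact
`greenbergStevens_kitagawa_twoVariable_interpolation_allBranches`.  Everything is proved; no named facts.

## References

* G. Shimura, *Introduction to the arithmetic theory of automorphic functions* (1971), §8.1, §8.3
  ((8.3.2), Prop. 8.5). [Shimura1971]
* R. Greenberg, G. Stevens, Invent. Math. 111 (1993), §1, §4–§6. [GreenbergStevens1993]
* K. Kitagawa, Contemp. Math. 165 (1994), §5. [Kitagawa1994]
-/

noncomputable section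

open scoped MatrixGroups
open CongruenceSubgroup Matrix

namespace Literature.NumberTheory.EllipticCurves

open ModularForms ModularForms.HidaCohomology

/-! ### Coefficient systems: right `M₂(ℤ)`-modules -/

/-- A **coefficient system**: an `R`-module `V` with a right action of `M₂(ℤ)` by `R`-linear maps,
`ρ (M M') = ρ M' ∘ ρ M`, `ρ 1 = id` (e.g. `Symⁿ`, `act n`; or the distributions `𝔻`, `actD`).
[folklore] -/
structure CoeffAction (R V : Type*) [CommRing R] [AddCommGroup V] [Module R V] where
  /-- the action of a matrix -/
  ρ : Matrix (Fin 2) (Fin 2) ℤ → (V →ₗ[R] V)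
  /-- right action: anti-multiplicativity -/
  ρ_mul : ∀ M M' : Matrix (Fin 2) (Fin 2) ℤ, ρ (M * M') = (ρ M').comp (ρ M)
  /-- the identity acts trivially -/
  ρ_one : ρ 1 = LinearMap.id

namespace CoeffAction

variable {R V W : Type*} [CommRing R] [AddCommGroup V] [Module R V] [AddCommGroup W] [Module R W]
  (A : CoeffAction R V) (B : CoeffAction R W)

/-- `ρ (M M') v = ρ M' (ρ M v)`. [folklore] -/
theorem ρ_mul_apply (M M' : Matrix (Fin 2) (Fin 2) ℤ) (v : V) : A.ρ (M * M') v = A.ρ M' (A.ρ M v) := by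
  rw [A.ρ_mul]; rfl

/-- **Inhomogeneous `1`-cocycles of `Γ₀(N)` with coefficients in `A`**: `u(γδ) = u(δ) + u(γ)·δ`
(the convention of `HidaOrdinaryCohomologyCocycles.cocycles`). [cite: Shimura1971, §8.1] -/
def cocycles (N : ℕ) : Submodule R (Gamma0 N → V) where
  carrier := {u | ∀ γ δ : Gamma0 N, u (γ * δ) = u δ + A.ρ (gmat δ) (u γ)}
  add_mem' := by
    intro u v hu hv γ δ
    simp only [Pi.add_apply, hu γ δ, hv γ δ, map_add]
    abel
  zero_mem' := fun γ δ => by simp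
  smul_mem' := by
    intro c u hu γ δ
    simp only [Pi.smul_apply, hu γ δ, smul_add, map_smul]

/-- Membership in `A.cocycles N`. [folklore] -/
theorem mem_cocycles_iff {N : ℕ} {u : Gamma0 N → V} :
    u ∈ A.cocycles N ↔ ∀ γ δ : Gamma0 N, u (γ * δ) = u δ + A.ρ (gmat δ) (u γ) := Iff.rfl

section Hecke

variable {N : ℕ} {p : ℕ} [NeZero p] (hp : p.Prime)

variable (N) in
/-- **Shimura's Hecke operator `[Γ₀(N) diag(1,p) Γ₀(N)]` on functions `Γ₀(N) → V`**:
`(U u)(γ) = Σᵢ u(γ'ᵢ)·β_{σ(i)}` (formula (8.3.2); `HidaOrdinaryCohomologyCocycles.heckeU` for `Symⁿ`).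
[cite: Shimura1971, §8.3 (8.3.2)] -/
def heckeU : (Gamma0 N → V) →ₗ[R] (Gamma0 N → V) where
  toFun u γ := ∑ i : HeckeIdx N p, A.ρ (heckeRep p (heckePerm hp γ i).1) (u (heckePermElt hp γ i))
  map_add' u v := by
    funext γ
    simp only [Pi.add_apply, map_add, Finset.sum_add_distrib]
  map_smul' c u := by
    funext γ
    simp only [Pi.smul_apply, map_smul, RingHom.id_apply, Finset.smul_sum]

/-- Unfolding `heckeU`. [folklore] -/
theorem heckeU_apply (u : Gamma0 N → V) (γ : Gamma0 N) :
    A.heckeU N hp u γ =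
      ∑ i : HeckeIdx N p, A.ρ (heckeRep p (heckePerm hp γ i).1) (u (heckePermElt hp γ i)) := rfl

/-- **`U_p` preserves cocycles** (the proof of `HidaOrdinaryCohomologyCocycles.heckeU_mem_cocycles`,
verbatim for a general coefficient system). [cite: Shimura1971, §8.3 Prop. 8.5] -/
theorem heckeU_mem_cocycles {u : Gamma0 N → V} (hu : u ∈ A.cocycles N) :
    A.heckeU N hp u ∈ A.cocycles N := by
  rw [mem_cocycles_iff] at hu ⊢
  intro γ δ
  rw [heckeU_apply, heckeU_apply, heckeU_apply, map_sum]
  have hterm : ∀ i : HeckeIdx N p,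
      A.ρ (heckeRep p (heckePerm hp (γ * δ) i).1) (u (heckePermElt hp (γ * δ) i)) =
        A.ρ (heckeRep p (heckePerm hp δ (heckePerm hp γ i)).1)
            (u (heckePermElt hp δ (heckePerm hp γ i))) +
          A.ρ (gmat δ) (A.ρ (heckeRep p (heckePerm hp γ i).1) (u (heckePermElt hp γ i))) := by
    intro i
    have e1 := heckePerm_mul hp γ δ i
    have e2 := heckePermElt_mul hp γ δ i
    have e3 := hu (heckePermElt hp γ i) (heckePermElt hp δ (heckePerm hp γ i))
    have e4 : A.ρ (heckeRep p (heckePerm hp δ (heckePerm hp γ i)).1)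
        (A.ρ (gmat (heckePermElt hp δ (heckePerm hp γ i))) (u (heckePermElt hp γ i))) =
        A.ρ (gmat δ) (A.ρ (heckeRep p (heckePerm hp γ i).1) (u (heckePermElt hp γ i))) := by
      simp only [← ρ_mul_apply, gmat_heckePermElt_mul hp δ]
    simp only [e1, e2, e3, map_add, e4]
  rw [Finset.sum_congr rfl fun i _ => hterm i, Finset.sum_add_distrib, add_left_inj]
  exact Finset.sum_equiv (heckePermEquiv hp γ) (fun i => by simp) (fun i _ => by
    rw [heckePermEquiv_apply])

variable (N) in
/-- **`U_p` on the module of cocycles.** [cite: Shimura1971, §8.3 Prop. 8.5] -/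
def heckeUZ : Module.End R (A.cocycles N) :=
  (A.heckeU N hp).restrict fun _ hu => A.heckeU_mem_cocycles hp hu

/-- Unfolding `heckeUZ`. [folklore] -/
@[simp] theorem coe_heckeUZ (u : A.cocycles N) :
    ((A.heckeUZ N hp u : A.cocycles N) : Gamma0 N → V) = A.heckeU N hp u := rfl

end Hecke

/-! ### Morphisms of coefficient systems -/

/-- A **morphism of coefficient systems**: an `R`-linear map intertwining the actions. [folklore] -/
structure Hom where
  /-- the underlying linear map -/
  toLinearMap : V →ₗ[R] W
  /-- equivariance -/
  comm : ∀ (M : Matrix (Fin 2) (Fin 2) ℤ) (v : V), toLinearMap (A.ρ M v) = B.ρ M (toLinearMap v)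

namespace Hom

variable {A B} (S : Hom A B)

/-- Post-composition with a morphism, on functions `Γ₀(N) → V`. [folklore] -/
def mapFun (N : ℕ) : (Gamma0 N → V) →ₗ[R] (Gamma0 N → W) where
  toFun u γ := S.toLinearMap (u γ)
  map_add' u v := by funext γ; simp
  map_smul' c u := by funext γ; simp

/-- Unfolding `mapFun`. [folklore] -/
@[simp] theorem mapFun_apply {N : ℕ} (u : Gamma0 N → V) (γ : Gamma0 N) :
    S.mapFun N u γ = S.toLinearMap (u γ) := rfl

/-- **A morphism of coefficient systems maps cocycles to cocycles.** [folklore] -/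
theorem mapFun_mem_cocycles {N : ℕ} {u : Gamma0 N → V} (hu : u ∈ A.cocycles N) :
    S.mapFun N u ∈ B.cocycles N := by
  rw [mem_cocycles_iff] at hu ⊢
  intro γ δ
  rw [mapFun_apply, mapFun_apply, mapFun_apply, hu γ δ, map_add, S.comm]

/-- **A morphism of coefficient systems commutes with `U_p`.** [folklore] -/
theorem mapFun_heckeU {N p : ℕ} [NeZero p] (hp : p.Prime) (u : Gamma0 N → V) :
    S.mapFun N (A.heckeU N hp u) = B.heckeU N hp (S.mapFun N u) := by
  funext γ
  rw [mapFun_apply, heckeU_apply, heckeU_apply, map_sum]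
  exact Finset.sum_congr rfl fun i _ => by rw [S.comm, mapFun_apply]

/-- The induced map on cocycles. [folklore] -/
def mapCocycles (N : ℕ) : A.cocycles N →ₗ[R] B.cocycles N :=
  (S.mapFun N).restrict fun _ hu => S.mapFun_mem_cocycles hu

/-- Unfolding `mapCocycles`. [folklore] -/
@[simp] theorem coe_mapCocycles {N : ℕ} (u : A.cocycles N) :
    ((S.mapCocycles N u : B.cocycles N) : Gamma0 N → W) = S.mapFun N u := rfl

/-- **The induced map on cocycles commutes with `U_p`.** [folklore] -/
theorem mapCocycles_heckeUZ {N p : ℕ} [NeZero p] (hp : p.Prime) (u : A.cocycles N) :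
    S.mapCocycles N (A.heckeUZ N hp u) = B.heckeUZ N hp (S.mapCocycles N u) :=
  Subtype.ext (by rw [coe_mapCocycles, coe_heckeUZ, coe_heckeUZ, coe_mapCocycles, mapFun_heckeU])

end Hom

end CoeffAction

/-! ### The coefficient systems `Symⁿ` and `𝔻`, and the specialisation morphisms -/

section Instances

/-- **The coefficient system `(R^{n+1}, act n)`** of `HidaOrdinaryCohomologyCocycles`. [folklore] -/
def symPowAction (n : ℕ) (R : Type*) [CommRing R] : CoeffAction R (Fin (n + 1) → R) where
  ρ := act n
  ρ_mul := act_mul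
  ρ_one := act_one

/-- Its cocycles are `HidaOrdinaryCohomologyCocycles.cocycles n N R`. [folklore] -/
theorem symPowAction_cocycles (n N : ℕ) (R : Type*) [CommRing R] :
    (symPowAction n R).cocycles N = HidaCohomology.cocycles n N R :=
  Submodule.ext fun _ => Iff.rfl

/-- Its `U_p` is `HidaOrdinaryCohomologyCocycles.heckeU n N R hp`. [folklore] -/
theorem symPowAction_heckeU (n N : ℕ) (R : Type*) [CommRing R] {p : ℕ} [NeZero p] (hp : p.Prime) :
    (symPowAction n R).heckeU N hp = HidaCohomology.heckeU n N R hp :=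
  LinearMap.ext fun _ => rfl

variable (p : ℕ) [Fact p.Prime]

/-- **The coefficient system `𝔻 = 𝔻(ℤ_p × ℤ_p)` of bounded `ℚ_p`-valued distributions** with the
right action `actD` (Greenberg–Stevens 1993, §1). [cite: GreenbergStevens1993, §1] -/
def distAction : CoeffAction ℚ_[p] ((padicIntSq p).distributions ℚ_[p]) where
  ρ := actD p ℚ_[p]
  ρ_mul := actD_mul
  ρ_one := actD_one

/-- **The weight-`n` specialisation `𝔻 → (ℚ_p^{n+1}, act n)` is a morphism of coefficient systems**
(`specializeₗ_actD`). [cite: GreenbergStevens1993, §4 (4.6)–(4.8)] -/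
def specializeHom (n : ℕ) : CoeffAction.Hom (distAction p) (symPowAction n ℚ_[p]) where
  toLinearMap := specializeₗ p n
  comm M μ := by
    change specializeₗ p n (actD p ℚ_[p] M μ) = act n M (specializeₗ p n μ)
    rw [specializeₗ_actD, act_apply]

variable {p}

/-- **`𝔻`-valued cocycles specialise to `Symⁿ`-valued cocycles in every weight.**
[cite: GreenbergStevens1993, §4–§5] -/
theorem specialize_mem_cocycles {N : ℕ} (n : ℕ) {U : Gamma0 N → (padicIntSq p).distributions ℚ_[p]}
    (hU : U ∈ (distAction p).cocycles N) :
    (specializeHom p n).mapFun N U ∈ HidaCohomology.cocycles n N ℚ_[p] := by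
  rw [← symPowAction_cocycles]
  exact (specializeHom p n).mapFun_mem_cocycles hU

/-- **The specialisation of `𝔻`-valued cocycles is `U_p`-equivariant** (note that `𝔻` and all the
`Symⁿ` carry the SAME Hecke operator formula; Greenberg–Stevens 1993, §5). [cite: GreenbergStevens1993, §5] -/
theorem specialize_heckeU {N : ℕ} (n : ℕ) {q : ℕ} [NeZero q] (hq : q.Prime)
    (U : Gamma0 N → (padicIntSq p).distributions ℚ_[p]) :
    (specializeHom p n).mapFun N ((distAction p).heckeU N hq U) =
      HidaCohomology.heckeU n N ℚ_[p] hq ((specializeHom p n).mapFun N U) := by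
  rw [← symPowAction_heckeU]
  exact (specializeHom p n).mapFun_heckeU hq U

end Instances

end Literature.NumberTheory.EllipticCurves

end
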